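import Summits.QuantumFields.BalabanUV.T4Continuum.Support.InsertionChannelInstance
import Summits.QuantumFields.BalabanUV.T4Continuum.Support.OutputRateFunctionalTablesPointwise

/-!
# InsertionChannelFamily — the NE5-W3 × NE9-S5 channel road (`InsertionChannelReading` ∕ `…End` ∕ `…Instance`) CARRIED TO ROAD D,
# part 1: the PER-CHART-POINT insertion of a FUNCTION TABLE by a localization channel of row NE9, and the damped-Lipschitz binder
# MI-3a of leaf-02's per-background slots (`OutputRateFunctionalTablesPointwise.PointwiseSlots`) DISCHARGED BY CONSTRUCTION from
# row NE9's displayed channel binders read on the table's BACKGROUND FAMILY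
# (cell `pub-balaban`, T⁴ fan-out; row NE5, node U3; `HOME/t4/formal/NE5/LEAVES.md` row O1-c follower; journal F3 l.15813, owner
# RULING R49 l.16073 «Road D OF RECORD», INTENT l.17278; part 2 = `InsertionChannelFamilyPiece`: the piece form of [II] (1.23)∕(1.33)
# at print's letters + the END over the original carriers)

Unit `b2b-balaban-t4-ne5-formalise-leaf-06` (NE5 formalisation swarm, leaf prover 06, gen 12).  Summits-side NEW WORK under the
LEAN PLACEMENT RULE (cell modelling + bookkeeping over ABSTRACT carriers; nothing of the manuscripts under audit is asserted; 0 cite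
tags; no `Prop`-valued fact minted — trigger `t4/T4-NE5-TRIGGER.json` c3).  HONEST FRAMING: rung (B)+1 of the FINITE-VOLUME T⁴
continuum programme — NOT infinite volume, NOT a mass gap, NOT the Clay problem, NOT a proof of NE5 (`T4OutputRate.NE5`, NOT
PRINTED; cell GAPS G-t4-U3-1) nor of NE9; spine 0/9 unchanged; 0/12 leaves instantiated on Bałaban's concrete objects (O1 = the
substrate cell, owner R34).  HONEST DEPENDENCY (cell line, verbatim): continuum YM on T⁴ ⇐ BetaPertH ∧ nine spine estimates (0/9
proved); BetaPertH ⇐ (D1) ∧ (D4) ∧ CAP+tail; G-an2-4 gates asym, D1 and NE2/3/4.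

WHY.  Owner RULING R48 located a defect of the value-table model of record at leaf MI-R: the kernel's insertion receives the earlier
terms as VALUES at one real background, whereas [Balaban1988RG2Cluster] Lemma 1 (1.33) p. 9 ∕ (1.23) p. 7 reads them as FUNCTIONS of
the background.  RULING R49 made leaf-02's ROAD D of record: the background is adjoined to the domain index
(`OutputRateFunctionalTables.paramCarriers C 𝒰`, tables `C.Dom × 𝒰 → ℝ`), the history currency is the sup-normed family
`Fam 𝒰 Hist` (part 2 there), and the layer the substrate instantiates is PER CHART POINT (part 3 `PointwiseSlots`: `insA g k t u : Hist`).
This lineage's channel road typed the READING of row NE9's localization channel `T k s H y` (`T4HistoryLipschitzRecursion`; family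
`H : Bg → C.Dom → ℝ` of old terms) by the value-table insertion through BACKGROUND-CONSTANT families `constFam t` — R48's defect seen
from the channel side: NE9's channel reads the term as a function of the background (the pieces of `NE9Lemma1Counting` are additive
maps `(Bg → ℝ) →+ ℝ` on the background dependence `U ↦ H U X`), but the value model could feed it constants only.  ON ROAD D THE TWO
OBJECTS COINCIDE (this lineage's F3, journal l.15813; leaf-02's `OutputRateFunctionalTablesFamily.toBgFamily`): with `𝒰 = Bg` a function
table `t : C.Dom × 𝒰 → ℝ` IS NE9's background family `toBgFamily t = fun u X ↦ t (X, u)`, and the channel reads it faithfully.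

WHAT THIS FILE TYPES ([folklore] bookkeeping; 0 sorry; every NE9 shape enters BY NAME as a displayed hypothesis, none is discharged):
* §1 DATA `chanEntries T out k g t u` (the step-`k` channel outputs on `toBgFamily t` as physical entries of the frame `F`, at the
  chart point `u`, through the output-index map `out : 𝒰 → F.Idx → ι`) and `insAtOfChannel T out g : ℕ → (C.Dom × 𝒰 → ℝ) → 𝒰 → Hist F`
  (step `0` nothing; step `k + 1` at `u` = `InsertionChannelInstance.tableOf F` of `chanEntries … k g t u`); `read_insAt_succ` — THE
  FUNCTION-TABLE READING DISPLAYED, per chart point, for a table whose channel entries there are level-bounded: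
  `F.read (insAtOfChannel T out g (k+1) t u) i = T k g (toBgFamily t) (out u i)`.
* §2 `norm_tableOf_sub_tableOf_le` — JUNK-ROBUST: two entry vectors within `B·F.wt` of each other give Hist vectors within `B`
  (both level-bounded: verbatim by `read_tableOf`; both not: both the junk `0`; a mixed pair cannot be `B·wt`-close) — the `tableOf`
  twin of leaf-02's `norm_famOf_sub_famOf_le`.
* §3 `abs_channel_sub_le` — for an EVERYWHERE-ADDITIVE channel (`ChannelAdditive univ T`, `ChannelStepSum univ T`,
  `ChannelSizeAtStepNN univ T κ wt τ`: row NE9's displayed binders on the class of ALL families) two function tables whose difference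
  is `≤ D(scale)·e^{−κd}` UNIFORMLY IN THE CHART have channel outputs within `wt k y·Σ_{j≤k} τ k j·D j`
  (`channelSizeNN_of_perStepNN` BY NAME on `toBgFamily (t − t′)`).
* §4 `norm_insAt_sub_le` — THE PER-CHART-POINT MI-3a BOUND for `insAtOfChannel` (Nat age normalisation `c·ω^{k−1−j}`) from §2 + §3
  + the profile `τ k j ≤ c·ω^{k−j}` + the WEIGHT DICTIONARY `0 ≤ wt k (out u i) ≤ rH (k+1)·F.wt i` (as in `InsertionChannelReading`,
  owner R30 (i): history-margin units); `insAt_eq_of_agree` — blindness above the step from `ChannelLocal univ T` (exact).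
* §5 FOR LEAF-02's PER-BACKGROUND SLOTS `P : PointwiseSlots C 𝒰 Op (Hist F)` WHOSE RUN-A INSERTION IS `insAtOfChannel T out` ON `W`:
  `insertionDampedNat_pointwise_of_insAt` (the per-point bound with `P.rHist`), **`insertionDamped_pointwise_of_insAt`** = EXACTLY
  the displayed `hdamp` hypothesis of `PointwiseSlots.ne5_of_pointwiseSlots` (p225051) — and of the owner's Re∕Im END on the same
  slots — with gain `c∕ω` (`T4InputCauchyRateData.mul_sum_age_shift`), the model-level `insertionDampedNat_of_insAt :
  P.toStepModel.InsertionDampedNat W κ c ω` (via `norm_famOf_sub_famOf_le`) and the exact `insBlind_of_insAt`.  NO homogeneity,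
  NO `InsAffine`, NO `ReadsChannel` hypothesis.

LOCATED DESIGN FACT (own lineage; nothing landed is false; journal D-ne5leaf06g12-1).  On Road D the inserted history of a function
table is a FAMILY over the chart (`Fam 𝒰 Hist`, through `famOf`); a table unbounded in the chart direction has an unbounded family of
inserted histories, read as the junk `0`.  Hence an exact reading equation for EVERY table at the family level — the analogue of
`InsertionChannelReading.ReadsChannel`, which on the value model holds by construction on finite-per-scale carriers
(`InsertionChannelInstance.readsChannel_insOfChannel_record`) — has NO by-construction instance over an infinite chart, and the kernel's
all-tables identity `StepModel.InsAffine` fails on mixed-junk pairs (kernel witness in part 2's toy; `InsAffine` stays ATTAINABLE on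
Road D only by a non-constructive ℝ-linear extension of the insertion off the chart-bounded tables — Mathlib's `LinearMap.exists_extend` —
never through `famOf`, whereas the exact family-level reading is IMPOSSIBLE for a channel with chart-unbounded outputs: an `ℓ^∞` family
has bounded read-outs); `ReadsChannel` itself does not even apply to the Road-D models (their history space is `Fam 𝒰 (Hist F)`, not a
`Hist F′`).  The kernel never needs the equation:
C0∕C1 and every Road-D END consume the INEQUALITY binder MI-3a (`InsertionDamped[Nat]`, per point `hdamp`), whose hypotheses make a
pair of tables either both faithful or both junk (§2, leaf-02's `norm_famOf_sub_famOf_le`) — and that binder IS discharged here.  On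
Road D the channel road's socket is therefore `hdamp`; PER CHART POINT the reading survives as `read_insAt_succ` on the tables whose
entries there are level-bounded (all of them on a frame with finitely many entries per scale read).
NOT IN THIS FILE (said plainly).  No instance on Bałaban's objects (which `T`, `out`, frame `F` and chart `𝒰` — the COMPLEX chart's
two real rows `𝒰ℂ × Fin 2` by R49 (4) — serve the record is the substrate's ∕ owner's reading; this file is polymorphic in all of
them); no NE9 binder discharged; no W1 ∕ W2 ∕ representation hypothesis touched; NE9-P2's evaluation channels
(`NE9EvaluationChannel.evalChannel`) are additive only on the ν-integrable class, not on all families, so their Road-D twin would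
carry the displayed class hypothesis «every function table's background family is admissible» — not typed here.  Headline wording
(owner R30 (ii) ∕ R35): «NE5 channel road (L09 ∕ MI-3a READ FROM row NE9's S5) carried to Road D — junction only»; never «leaf
instantiated».  NE5 NOT PROVED; NE9 NOT PROVED; spine 0/9; rung (B)+1 finite T⁴; NOT infinite volume ∕ mass gap ∕ Clay.
Axioms ⊆ {propext, Classical.choice, Quot.sound}.
-/

noncomputable section

open scoped BigOperators
open Finset Function Metric Set

namespace Summit.QuantumFields.BalabanUV.T4Continuum.InsertionChannelFamily

open Literature.MathematicalPhysics.QuantumFieldTheory.Balaban1983to89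
open Literature.MathematicalPhysics.QuantumFieldTheory.Balaban1983to89.T4OutputRate (Carriers)
open Literature.MathematicalPhysics.QuantumFieldTheory.Balaban1983to89.T4InputCauchyRateData (StepModel mul_sum_age_shift)
open Literature.MathematicalPhysics.QuantumFieldTheory.Balaban1983to89.T4HistoryLipschitzRecursion
  (ChannelAdditive ChannelLocal ChannelStepSum ChannelSizeAtStepNN AdmRestrict truncScale channelSizeNN_of_perStepNN)
open Summit.QuantumFields.BalabanUV.T4Continuum.B13HistDatum (HistFrame Hist)
open Summit.QuantumFields.BalabanUV.T4Continuum.InsertionChannelReading (read_sub)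
open Summit.QuantumFields.BalabanUV.T4Continuum.InsertionChannelInstance (tableOf read_tableOf)
open Summit.QuantumFields.BalabanUV.T4Continuum.OutputRateFunctionalTables
open Summit.QuantumFields.BalabanUV.T4Continuum.OutputRateFunctionalTablesFamily (famOf toBgFamily norm_famOf_sub_famOf_le)
open Summit.QuantumFields.BalabanUV.T4Continuum.OutputRateFunctionalTablesPointwise (PointwiseSlots)

variable {C : Carriers} {𝒰 ι : Type} {F : HistFrame C}

/-! ## §1 The per-chart-point insertion of a function table by a channel, and the reading displayed -/

section Data

variable (T : ℕ → (ℕ → ℝ) → (𝒰 → C.Dom → ℝ) → ι → ℝ) (out : 𝒰 → F.Idx → ι)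

/-- [folklore] DATA: the step-`k` channel outputs on the BACKGROUND FAMILY `toBgFamily t` of a function table, as physical entries of
the frame `F` AT the chart point `u` (the entry `i` reads the output index `out u i` — on the record the localized potential's
arguments `(Y, U_{k+1}, B′)` of (1.33), the background coordinate being the chart point; a reading, generic here). -/
def chanEntries (k : ℕ) (g : ℕ → ℝ) (t : C.Dom × 𝒰 → ℝ) (u : 𝒰) : F.Idx → ℂ :=
  fun i => ((T k g (toBgFamily t) (out u i) : ℝ) : ℂ)

/-- [folklore] DATA: THE PER-CHART-POINT INSERTION OF A FUNCTION TABLE BY THE CHANNEL — step `0` inserts nothing; step `k + 1` at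
the chart point `u` inserts the Hist vector whose physical entries are the step-`k` channel outputs on the table's background family
(`InsertionChannelInstance.tableOf`: verbatim when level-bounded, the junk `0` otherwise — never met by the binders below except
pairwise, §2).  The shape of `PointwiseSlots.insA g` (leaf-02, part 3). -/
def insAtOfChannel (g : ℕ → ℝ) : ℕ → (C.Dom × 𝒰 → ℝ) → 𝒰 → Hist F
  | 0, _ => fun _ => 0
  | k + 1, t => fun u => tableOf F (chanEntries T out k g t u)

/-- [folklore] Step `0` inserts nothing. -/
@[simp] theorem insAtOfChannel_zero (g : ℕ → ℝ) (t : C.Dom × 𝒰 → ℝ) (u : 𝒰) : insAtOfChannel T out g 0 t u = 0 := rfl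

/-- [folklore] Step `k + 1` inserts the table of the step-`k` channel entries. -/
theorem insAtOfChannel_succ (g : ℕ → ℝ) (k : ℕ) (t : C.Dom × 𝒰 → ℝ) (u : 𝒰) :
    insAtOfChannel T out g (k + 1) t u = tableOf F (chanEntries T out k g t u) := rfl

/-- [folklore] **THE FUNCTION-TABLE READING, DISPLAYED**: for a table whose step-`k` channel entries at `u` are level-bounded, the
entry `i` of the history inserted at step `k + 1` and chart point `u` IS the step-`k` channel output on the table's BACKGROUND FAMILY
at the index `out u i` — [II] (1.33) read with the earlier terms as FUNCTIONS of the background (`toBgFamily t u X = t (X, u)`), the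
reading the value-table model (`InsertionChannelReading.ReadsChannel … (constFam t)`) could not express (owner R48). -/
theorem read_insAt_succ {g : ℕ → ℝ} {k : ℕ} {t : C.Dom × 𝒰 → ℝ} {u : 𝒰}
    (h : ∃ μ : ℝ, ∀ i, ‖chanEntries T out k g t u i‖ ≤ μ * F.wt i) (i : F.Idx) :
    F.read (insAtOfChannel T out g (k + 1) t u) i = ((T k g (toBgFamily t) (out u i) : ℝ) : ℂ) := by
  rw [insAtOfChannel_succ, read_tableOf h]
  rfl

end Data

/-! ## §2 The junk-robust norm lemma for `tableOf` -/

section TableOf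

/-- [folklore] **TWO ENTRY VECTORS WITHIN `B·wt` OF EACH OTHER GIVE HIST VECTORS WITHIN `B`** — `tableOf` is met only pairwise: if
`V` is level-bounded so is `V′` (by `μ + B`) and the read-outs are verbatim (`read_tableOf`, `HistFrame.norm_le_iff_read`); if `V`
is not, neither is `V′`, both are the junk `0`, and `0 ≤ B`.  The `tableOf` twin of leaf-02's `norm_famOf_sub_famOf_le`. -/
theorem norm_tableOf_sub_tableOf_le {V V' : F.Idx → ℂ} {B : ℝ} (hB : 0 ≤ B) (h : ∀ i, ‖V i - V' i‖ ≤ B * F.wt i) :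
    ‖tableOf F V - tableOf F V'‖ ≤ B := by
  classical
  by_cases hV : ∃ μ : ℝ, ∀ i, ‖V i‖ ≤ μ * F.wt i
  · have hV' : ∃ μ : ℝ, ∀ i, ‖V' i‖ ≤ μ * F.wt i := by
      obtain ⟨μ, hμ⟩ := hV
      refine ⟨μ + B, fun i => ?_⟩
      calc ‖V' i‖ = ‖V i - (V i - V' i)‖ := by rw [sub_sub_cancel]
        _ ≤ ‖V i‖ + ‖V i - V' i‖ := norm_sub_le _ _
        _ ≤ μ * F.wt i + B * F.wt i := add_le_add (hμ i) (h i)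
        _ = (μ + B) * F.wt i := by ring
    refine (F.norm_le_iff_read _ hB).2 fun i => ?_
    rw [read_sub, read_tableOf hV, read_tableOf hV']
    exact h i
  · have hV' : ¬ ∃ μ : ℝ, ∀ i, ‖V' i‖ ≤ μ * F.wt i := by
      rintro ⟨μ, hμ⟩
      refine hV ⟨μ + B, fun i => ?_⟩
      calc ‖V i‖ = ‖V i - V' i + V' i‖ := by rw [sub_add_cancel]
        _ ≤ ‖V i - V' i‖ + ‖V' i‖ := norm_add_le _ _
        _ ≤ B * F.wt i + μ * F.wt i := add_le_add (h i) (hμ i)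
        _ = (μ + B) * F.wt i := by ring
    rw [tableOf, dif_neg hV, tableOf, dif_neg hV', sub_zero, norm_zero]
    exact hB

end TableOf

/-! ## §3 The channel bound on function-table differences, from row NE9's binders on ALL families -/

section Channel

variable {T : ℕ → (ℕ → ℝ) → (𝒰 → C.Dom → ℝ) → ι → ℝ}

/-- [folklore] The class of ALL families is closed under one-step restriction and truncation. -/
theorem admRestrict_univ : AdmRestrict (C := C) (Set.univ : Set (𝒰 → C.Dom → ℝ)) :=
  ⟨fun _ _ _ => Set.mem_univ _, fun _ _ _ => Set.mem_univ _⟩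

/-- [folklore] `toBgFamily` is additive. -/
theorem toBgFamily_sub (t t' : C.Dom × 𝒰 → ℝ) : toBgFamily (t - t') = toBgFamily t - toBgFamily t' := rfl

/-- [folklore] `toBgFamily`, evaluated. -/
@[simp] theorem toBgFamily_apply (t : C.Dom × 𝒰 → ℝ) (u : 𝒰) (X : C.Dom) : toBgFamily t u X = t (X, u) := rfl

/-- [folklore] Tables agreeing on the scales `≤ k` have background families with the same step-`k` truncation. -/
theorem truncScale_toBgFamily_eq {k : ℕ} {t t' : C.Dom × 𝒰 → ℝ} (h : ∀ Y, C.scale Y ≤ k → ∀ u, t (Y, u) = t' (Y, u)) :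
    truncScale k (toBgFamily t) = truncScale k (toBgFamily t') := by
  funext u X
  simp only [truncScale, toBgFamily_apply]
  by_cases hX : C.scale X ≤ k
  · rw [if_pos hX, if_pos hX, h X hX u]
  · rw [if_neg hX, if_neg hX]

/-- [folklore] **THE CHANNEL OUTPUTS OF TWO FUNCTION TABLES WHOSE DIFFERENCE IS SMALL UNIFORMLY IN THE CHART** — for a channel that is
ADDITIVE on all families with the printed STEP-SUM structure and row NE9's per-creation-step SIZE binder `ChannelSizeAtStepNN univ T κ wt τ`
(displayed, BY NAME): if `|t (Y, u) − t′ (Y, u)| ≤ D(scale Y)·e^{−κd(Y)}` at every scale `≤ k` and every chart point, then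
`|T k g (toBgFamily t) y − T k g (toBgFamily t′) y| ≤ wt k y·Σ_{j≤k} τ k j·D j` (`channelSizeNN_of_perStepNN` on `toBgFamily (t − t′)`). -/
theorem abs_channel_sub_le {κ : ℝ} {wt : ℕ → ι → ℝ} {τ : ℕ → ℕ → ℝ}
    (hadd : ChannelAdditive (Set.univ : Set (𝒰 → C.Dom → ℝ)) T) (hsum : ChannelStepSum (Set.univ : Set (𝒰 → C.Dom → ℝ)) T)
    (hsize : ChannelSizeAtStepNN (Set.univ : Set (𝒰 → C.Dom → ℝ)) T κ wt τ) {k : ℕ} (g : ℕ → ℝ) {t t' : C.Dom × 𝒰 → ℝ}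
    {D : ℕ → ℝ} (hD : ∀ j ≤ k, 0 ≤ D j)
    (hb : ∀ Y, C.scale Y ≤ k → ∀ u, |t (Y, u) - t' (Y, u)| ≤ D (C.scale Y) * Real.exp (-(κ * C.d Y))) (y : ι) :
    |T k g (toBgFamily t) y - T k g (toBgFamily t') y| ≤ wt k y * ∑ j ∈ range (k + 1), τ k j * D j := by
  have hdiff : T k g (toBgFamily t) y - T k g (toBgFamily t') y = T k g (toBgFamily (t - t')) y := by
    rw [toBgFamily_sub]
    exact (hadd k g _ (Set.mem_univ _) _ (Set.mem_univ _) y).symm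
  rw [hdiff]
  have hNN := channelSizeNN_of_perStepNN admRestrict_univ hsum hsize k g (toBgFamily (t - t')) (Set.mem_univ _)
    (fun j => if j ≤ k then D j else 0) (fun j => by
      by_cases hj : j ≤ k
      · rw [if_pos hj]; exact hD j hj
      · rw [if_neg hj])
    (fun u X hX => by
      rw [if_pos hX, mul_comm]
      exact hb X hX u) y
  refine hNN.trans (le_of_eq ?_)
  congr 1
  refine sum_congr rfl fun j hj => ?_
  rw [if_pos (Nat.lt_succ_iff.1 (mem_range.1 hj))]

end Channel

/-! ## §4 The per-chart-point MI-3a bound for `insAtOfChannel`, and blindness above the step -/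

section InsAt

variable {T : ℕ → (ℕ → ℝ) → (𝒰 → C.Dom → ℝ) → ι → ℝ} {out : 𝒰 → F.Idx → ι}

/-- [folklore] **THE PER-CHART-POINT DAMPED-LIPSCHITZ BOUND OF THE CHANNEL INSERTION** (Nat age normalisation): for an everywhere-additive
channel with the step-sum structure and row NE9's size binder, the profile `τ k j ≤ c·ω^{k−j}` (`0 ≤ c`, `0 ≤ ω`) and the WEIGHT DICTIONARY
`0 ≤ wt k (out u i) ≤ rH (k+1)·F.wt i` (history-margin units `rH`, `0 ≤ rH`), two function tables within `D(scale)·e^{−κd}` of each other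
on the scales `< k`, uniformly in the chart, are inserted at step `k` within `rH k·c·Σ_{j<k} ω^{k−1−j} D j` AT EVERY chart point — §3 entry
by entry, assembled by the junk-robust §2. -/
theorem norm_insAt_sub_le {κ c ω : ℝ} {wt : ℕ → ι → ℝ} {τ : ℕ → ℕ → ℝ} {rH : ℕ → ℝ}
    (hadd : ChannelAdditive (Set.univ : Set (𝒰 → C.Dom → ℝ)) T) (hsum : ChannelStepSum (Set.univ : Set (𝒰 → C.Dom → ℝ)) T)
    (hsize : ChannelSizeAtStepNN (Set.univ : Set (𝒰 → C.Dom → ℝ)) T κ wt τ) (hwt0 : ∀ k u i, 0 ≤ wt k (out u i))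
    (hwt : ∀ k u i, wt k (out u i) ≤ rH (k + 1) * F.wt i) (hτ : ∀ k j, j ≤ k → τ k j ≤ c * ω ^ (k - j)) (hc : 0 ≤ c)
    (hω : 0 ≤ ω) (hrH : ∀ k, 0 ≤ rH k) (k : ℕ) (g : ℕ → ℝ) {t t' : C.Dom × 𝒰 → ℝ} {D : ℕ → ℝ} (hD : ∀ j < k, 0 ≤ D j)
    (hb : ∀ Y, C.scale Y < k → ∀ u, |t (Y, u) - t' (Y, u)| ≤ D (C.scale Y) * Real.exp (-(κ * C.d Y))) (u : 𝒰) :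
    ‖insAtOfChannel T out g k t u - insAtOfChannel T out g k t' u‖ ≤ rH k * (c * ∑ j ∈ range k, ω ^ (k - 1 - j) * D j) := by
  cases k with
  | zero => simp [insAtOfChannel]
  | succ k =>
    have hD' : ∀ j ≤ k, 0 ≤ D j := fun j hj => hD j (Nat.lt_succ_of_le hj)
    simp only [add_tsub_cancel_right, insAtOfChannel_succ]
    have hS0 : 0 ≤ ∑ j ∈ range (k + 1), ω ^ (k - j) * D j :=
      sum_nonneg fun j hj => mul_nonneg (pow_nonneg hω _) (hD' j (Nat.lt_succ_iff.1 (mem_range.1 hj)))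
    have hB : 0 ≤ rH (k + 1) * (c * ∑ j ∈ range (k + 1), ω ^ (k - j) * D j) :=
      mul_nonneg (hrH _) (mul_nonneg hc hS0)
    refine norm_tableOf_sub_tableOf_le hB fun i => ?_
    rw [chanEntries, chanEntries, ← Complex.ofReal_sub, Complex.norm_real, Real.norm_eq_abs]
    calc |T k g (toBgFamily t) (out u i) - T k g (toBgFamily t') (out u i)|
        ≤ wt k (out u i) * ∑ j ∈ range (k + 1), τ k j * D j :=
          abs_channel_sub_le hadd hsum hsize g hD' (fun Y hY u => hb Y (Nat.lt_succ_of_le hY) u) (out u i)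
      _ ≤ wt k (out u i) * ∑ j ∈ range (k + 1), c * ω ^ (k - j) * D j :=
          mul_le_mul_of_nonneg_left (sum_le_sum fun j hj =>
            mul_le_mul_of_nonneg_right (hτ k j (Nat.lt_succ_iff.1 (mem_range.1 hj)))
              (hD' j (Nat.lt_succ_iff.1 (mem_range.1 hj)))) (hwt0 k u i)
      _ = wt k (out u i) * (c * ∑ j ∈ range (k + 1), ω ^ (k - j) * D j) := by
          congr 1
          rw [mul_sum]
          exact sum_congr rfl fun j _ => by ring
      _ ≤ rH (k + 1) * F.wt i * (c * ∑ j ∈ range (k + 1), ω ^ (k - j) * D j) :=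
          mul_le_mul_of_nonneg_right (hwt k u i) (mul_nonneg hc hS0)
      _ = rH (k + 1) * (c * ∑ j ∈ range (k + 1), ω ^ (k - j) * D j) * F.wt i := by ring

/-- [folklore] **BLINDNESS ABOVE THE STEP, EXACT** — from `ChannelLocal univ T` (the step-`k` channel reads only the creation steps `≤ k`):
two function tables agreeing on the scales `< k` are inserted identically at step `k`, at every chart point (junk or not: the entry
vectors are literally equal). -/
theorem insAt_eq_of_agree (hloc : ChannelLocal (Set.univ : Set (𝒰 → C.Dom → ℝ)) T) (k : ℕ) (g : ℕ → ℝ)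
    {t t' : C.Dom × 𝒰 → ℝ} (h : ∀ Y, C.scale Y < k → ∀ u, t (Y, u) = t' (Y, u)) (u : 𝒰) :
    insAtOfChannel T out g k t u = insAtOfChannel T out g k t' u := by
  cases k with
  | zero => rfl
  | succ k =>
    simp only [insAtOfChannel_succ]
    congr 1
    funext i
    simp only [chanEntries]
    rw [hloc k g _ (Set.mem_univ _) (out u i), hloc k g (toBgFamily t') (Set.mem_univ _) (out u i),
      truncScale_toBgFamily_eq fun Y hY u => h Y (Nat.lt_succ_of_le hY) u]

end InsAt

/-! ## §5 Leaf-02's per-background slots whose run-A insertion IS the channel insertion: `hdamp` discharged -/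

section Slots

variable {Op : Type*} [NormedAddCommGroup Op] [NormedSpace ℂ Op] (P : PointwiseSlots C 𝒰 Op (Hist F))
  {T : ℕ → (ℕ → ℝ) → (𝒰 → C.Dom → ℝ) → ι → ℝ} {out : 𝒰 → F.Idx → ι} {W : Set (ℕ → ℝ)}

/-- [folklore] **THE PER-CHART-POINT MI-3a BINDER OF PER-BACKGROUND SLOTS READING A CHANNEL, Nat normalisation**: if run A's per-point
insertion IS `insAtOfChannel T out` on the window, then for every `g ∈ W` the displayed per-point damped-Lipschitz bound holds with the
slots' history margins `P.rHist` — from the channel's three binders on all families, the profile and the weight dictionary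
`0 ≤ wt k (out u i) ≤ P.rHist (k+1)·F.wt i`.  NO homogeneity, NO affinity, NO reading equation is used. -/
theorem insertionDampedNat_pointwise_of_insAt {κ c ω : ℝ} {wt : ℕ → ι → ℝ} {τ : ℕ → ℕ → ℝ}
    (hins : ∀ k, ∀ g ∈ W, ∀ (t : C.Dom × 𝒰 → ℝ) (u : 𝒰), P.insA g k t u = insAtOfChannel T out g k t u)
    (hadd : ChannelAdditive (Set.univ : Set (𝒰 → C.Dom → ℝ)) T) (hsum : ChannelStepSum (Set.univ : Set (𝒰 → C.Dom → ℝ)) T)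
    (hsize : ChannelSizeAtStepNN (Set.univ : Set (𝒰 → C.Dom → ℝ)) T κ wt τ) (hwt0 : ∀ k u i, 0 ≤ wt k (out u i))
    (hwt : ∀ k u i, wt k (out u i) ≤ P.rHist (k + 1) * F.wt i) (hτ : ∀ k j, j ≤ k → τ k j ≤ c * ω ^ (k - j)) (hc : 0 ≤ c)
    (hω : 0 ≤ ω) :
    ∀ k, ∀ g ∈ W, ∀ (t t' : C.Dom × 𝒰 → ℝ) (D : ℕ → ℝ), (∀ j < k, 0 ≤ D j) →
      (∀ Y, C.scale Y < k → ∀ u, |t (Y, u) - t' (Y, u)| ≤ D (C.scale Y) * Real.exp (-(κ * C.d Y))) →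
        ∀ u, ‖P.insA g k t u - P.insA g k t' u‖ ≤ P.rHist k * (c * ∑ j ∈ range k, ω ^ (k - 1 - j) * D j) := by
  intro k g hg t t' D hD hb u
  rw [hins k g hg t u, hins k g hg t' u]
  exact norm_insAt_sub_le hadd hsum hsize hwt0 hwt hτ hc hω (fun k => (P.rHist_pos k).le) k g hD hb u

/-- [folklore] **THE SAME IN THE KERNEL's C0 NORMALISATION — EXACTLY THE `hdamp` HYPOTHESIS OF `PointwiseSlots.ne5_of_pointwiseSlots`**
(leaf-02, p225051; and of the owner's Re∕Im END on the same slots): gain `c∕ω`, weights `ω^{k−j}` (`mul_sum_age_shift`, `0 < ω`). -/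
theorem insertionDamped_pointwise_of_insAt {κ c ω : ℝ} {wt : ℕ → ι → ℝ} {τ : ℕ → ℕ → ℝ}
    (hins : ∀ k, ∀ g ∈ W, ∀ (t : C.Dom × 𝒰 → ℝ) (u : 𝒰), P.insA g k t u = insAtOfChannel T out g k t u)
    (hadd : ChannelAdditive (Set.univ : Set (𝒰 → C.Dom → ℝ)) T) (hsum : ChannelStepSum (Set.univ : Set (𝒰 → C.Dom → ℝ)) T)
    (hsize : ChannelSizeAtStepNN (Set.univ : Set (𝒰 → C.Dom → ℝ)) T κ wt τ) (hwt0 : ∀ k u i, 0 ≤ wt k (out u i))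
    (hwt : ∀ k u i, wt k (out u i) ≤ P.rHist (k + 1) * F.wt i) (hτ : ∀ k j, j ≤ k → τ k j ≤ c * ω ^ (k - j)) (hc : 0 ≤ c)
    (hω : 0 < ω) :
    ∀ k, ∀ g ∈ W, ∀ (t t' : C.Dom × 𝒰 → ℝ) (D : ℕ → ℝ), (∀ j < k, 0 ≤ D j) →
      (∀ Y, C.scale Y < k → ∀ u, |t (Y, u) - t' (Y, u)| ≤ D (C.scale Y) * Real.exp (-(κ * C.d Y))) →
        ∀ u, ‖P.insA g k t u - P.insA g k t' u‖ ≤ P.rHist k * (c / ω * ∑ j ∈ range k, ω ^ (k - j) * D j) := by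
  intro k g hg t t' D hD hb u
  rw [← mul_sum_age_shift hω.ne' c D]
  exact insertionDampedNat_pointwise_of_insAt P hins hadd hsum hsize hwt0 hwt hτ hc hω.le k g hg t t' D hD hb u

/-- [folklore] **MODEL LEVEL: `InsertionDampedNat` OF THE FAMILY MODEL over `paramCarriers C 𝒰`** (nonempty chart) — the per-point bound
lifted through `famOf` by leaf-02's `norm_famOf_sub_famOf_le` (both families bounded: verbatim; both unbounded: both junk). -/
theorem insertionDampedNat_of_insAt [Nonempty 𝒰] {κ c ω : ℝ} {wt : ℕ → ι → ℝ} {τ : ℕ → ℕ → ℝ}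
    (hins : ∀ k, ∀ g ∈ W, ∀ (t : C.Dom × 𝒰 → ℝ) (u : 𝒰), P.insA g k t u = insAtOfChannel T out g k t u)
    (hadd : ChannelAdditive (Set.univ : Set (𝒰 → C.Dom → ℝ)) T) (hsum : ChannelStepSum (Set.univ : Set (𝒰 → C.Dom → ℝ)) T)
    (hsize : ChannelSizeAtStepNN (Set.univ : Set (𝒰 → C.Dom → ℝ)) T κ wt τ) (hwt0 : ∀ k u i, 0 ≤ wt k (out u i))
    (hwt : ∀ k u i, wt k (out u i) ≤ P.rHist (k + 1) * F.wt i) (hτ : ∀ k j, j ≤ k → τ k j ≤ c * ω ^ (k - j)) (hc : 0 ≤ c)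
    (hω : 0 ≤ ω) : P.toStepModel.InsertionDampedNat W κ c ω := by
  intro k g hg _ t t' D hD hb
  exact norm_famOf_sub_famOf_le
    (insertionDampedNat_pointwise_of_insAt P hins hadd hsum hsize hwt0 hwt hτ hc hω k g hg t t' D hD (fun Y hY u => hb (Y, u) hY))

/-- [folklore] **MODEL LEVEL: `InsBlind` OF THE FAMILY MODEL, EXACT** — from `ChannelLocal univ T` (`insAt_eq_of_agree` at every chart
point; the two raw families are equal, so are their `famOf`). -/
theorem insBlind_of_insAt (hins : ∀ k, ∀ g ∈ W, ∀ (t : C.Dom × 𝒰 → ℝ) (u : 𝒰), P.insA g k t u = insAtOfChannel T out g k t u)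
    (hloc : ChannelLocal (Set.univ : Set (𝒰 → C.Dom → ℝ)) T) : P.toStepModel.InsBlind W := by
  intro k g hg _ t t' h
  show famOf (P.insA g k t) = famOf (P.insA g k t')
  have : P.insA g k t = P.insA g k t' := funext fun u => by
    rw [hins k g hg t u, hins k g hg t' u]
    exact insAt_eq_of_agree hloc k g (fun Y hY u => h (Y, u) hY) u
  rw [this]

end Slots

end Summit.QuantumFields.BalabanUV.T4Continuum.InsertionChannelFamily

end
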